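import Summits.CriticalPhenomena.PercolationContinuityZ3.Theses.PercBudgetLadder
import Summits.CriticalPhenomena.PercolationContinuityZ3.Theses.PercAnnulusCrossing
import Literature.Probability.Percolation.MinOpenCut
import Literature.Probability.Percolation.SharpnessDCTProofs

/-!
# `BudgetTightness` (crux stmt-CriticalPhenomena-5248) — negative lemmas: degenerate aspects, `p = 1`, kill propagation

Route `PercBudgetLadder`, crux r2 `BudgetTightness`: `∃ k l c, 2 ≤ l ∧ 0 < c ∧ ∀ N ∃ n ≥ N,
c ≤ P_{p_c(ℤ³)}(∃ S, #S ≤ k ∧ no open crossing B(n) → ∂ⁱⁿB(l n) inside B(l n) in ω \ S)`.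

Refuter (cdisprove) findings, all sorry-free:
* `blocked_eq_empty_of_le` — for `m ≤ n` the budget event of `B(n) → ∂ⁱⁿB(m)` is EMPTY (the corner
  `(m,m,m)` lies in `B(n) ∩ ∂ⁱⁿB(m)` and is joined to itself whatever is closed); hence
  `budgetTightness_aspect_le_one_false`: the instances `l ≤ 1` of the crux are void and the guard
  `2 ≤ l` is cosmetic (it changes no truth value).
* `budgetTightness_at_one_false` — the crux with `p_c` replaced by `p = 1` is FALSE: under `P_1 = δ_{E(ℤ³)}`
  the rows `{(t, j, 0) : n ≤ t ≤ l n}`, `j = 0..k`, are `k + 1` edge-disjoint open crossings, and `k`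
  closed edges miss one of them. So `{p | tightness at p}` — a down-set of `[0,1]` since the event is
  decreasing — is proper, and any proof must use `p_c(ℤ³) < 1`.
* KILL PROPAGATION: `not_critAnnulusBlockedIO_of_not_budgetTightness` (the route's target X implies r2,
  `k = 0`) and `not_critAnnulusNonCrossing_of_not_budgetTightness` (so does `X_B` of route
  `PercAnnulusCrossing`, by complement at `l = 2`): a refutation of r2 would sink both.

References: G. Grimmett, Percolation (1999), §1.3 (`P_1`), §13.1 (cutsets, weak duality).
-/

noncomputable section

open MeasureTheory ProbabilityTheory Filter Topology
open Literature.Probability.Percolation Literature.Probability.LatticeModels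
open Literature.Probability.Percolation.DCT16 (mem_openConnIn_of_pathIn)

namespace Summit.CriticalPhenomena.PercolationContinuityZ3.Theorems.BudgetTightness.Negative

/-! ## Degenerate aspects -/

/-- For `m ≤ n` the point `(m, …, m)` lies in `B(n) ∩ ∂ⁱⁿB(m)`. [folklore] -/
theorem const_mem_box_inter_innerBoundary {d : ℕ} [NeZero d] {n m : ℕ} (h : m ≤ n) :
    (fun _ => (m : ℤ) : Site d) ∈ box d n ∧
      (fun _ => (m : ℤ) : Site d) ∈ innerBoundary (zdGraph d) (box d m) := by
  refine ⟨?_, ?_⟩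
  · rw [mem_box]; intro i; constructor <;> omega
  · rw [mem_innerBoundary_iff]
    refine ⟨?_, (fun _ => (m : ℤ)) + Pi.single 0 1, ?_, ?_⟩
    · rw [mem_box]; intro i; constructor <;> omega
    · rw [mem_box]; intro hcon
      have := (hcon 0).2
      simp at this
    · rw [zdGraph_adj_iff]; exact ⟨0, Or.inl rfl⟩

/-- **Degenerate aspect: for `m ≤ n` the budget event is EMPTY** — a vertex of `B(n) ∩ ∂ⁱⁿB(m)` is
joined to itself by the trivial open path whatever is closed. [folklore] -/
theorem blocked_eq_empty_of_le {d : ℕ} [NeZero d] (k : ℕ) {n m : ℕ} (h : m ≤ n) :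
    {ω : BondConfig (Site d) | ∃ S : Finset (Sym2 (Site d)), S.card ≤ k ∧
      ¬ ∃ x ∈ box d n, ∃ y ∈ innerBoundary (zdGraph d) (box d m),
        (ω \ ↑S) ∈ openConnIn (↑(box d m) : Set (Site d)) x y} = ∅ := by
  ext ω
  simp only [Set.mem_empty_iff_false, iff_false, Set.mem_setOf_eq]
  rintro ⟨S, -, hS⟩
  obtain ⟨hx, hy⟩ := const_mem_box_inter_innerBoundary (d := d) h
  refine hS ⟨_, hx, _, hy, ?_⟩
  have hxm : (fun _ => (m : ℤ) : Site d) ∈ (↑(box d m) : Set (Site d)) :=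
    Finset.mem_coe.2 (mem_innerBoundary_iff.1 hy).1
  exact ⟨hxm, hxm, SimpleGraph.Reachable.refl _⟩

/-- **The instances `l ≤ 1` of the crux are void** (any parameter): with `l n ≤ n` the event is empty,
so its probability is `0 < c`. The guard `2 ≤ l` in `BudgetTightness` is therefore cosmetic. [folklore] -/
theorem budgetTightness_aspect_le_one_false (p : unitInterval) :
    ¬ ∃ (k l : ℕ) (c : ℝ), l ≤ 1 ∧ 0 < c ∧ ∀ N : ℕ, ∃ n : ℕ, N ≤ n ∧
      c ≤ (bondPercolation (zdGraph 3) p).real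
        {ω : BondConfig (Site 3) | ∃ S : Finset (Sym2 (Site 3)), S.card ≤ k ∧
          ¬ ∃ x ∈ box 3 n, ∃ y ∈ innerBoundary (zdGraph 3) (box 3 (l * n)),
            (ω \ ↑S) ∈ openConnIn (↑(box 3 (l * n)) : Set (Site 3)) x y} := by
  rintro ⟨k, l, c, hl, hc, h⟩
  obtain ⟨n, -, hn⟩ := h 0
  rw [blocked_eq_empty_of_le k (by nlinarith), measureReal_empty] at hn
  exact absurd hn (not_le.2 hc)

/-! ## The parameter `p = 1` -/

/-- At `p = 1` the configuration is a.s. the full edge set. [folklore] -/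
theorem bondPercolation_one {V : Type*} (G : SimpleGraph V) :
    bondPercolation G 1 = Measure.dirac G.edgeSet := by
  unfold bondPercolation
  exact setBernoulli_one _

/-- Consecutive row points are lattice neighbours: `(n+t+1, j, 0) = (n+t, j, 0) + e₀`. [folklore] -/
theorem row_succ (n t j : ℕ) :
    (![(n : ℤ) + (t + 1 : ℕ), (j : ℤ), 0] : Site 3) = ![(n : ℤ) + t, (j : ℤ), 0] + Pi.single 0 1 := by
  ext i
  fin_cases i <;> simp; ring

/-- Row points are adjacent in `ℤ³`. [folklore] -/
theorem row_adj (n t j : ℕ) :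
    (zdGraph 3).Adj (![(n : ℤ) + t, (j : ℤ), 0] : Site 3) ![(n : ℤ) + (t + 1 : ℕ), (j : ℤ), 0] := by
  rw [zdGraph_adj_iff]
  exact ⟨0, Or.inl (row_succ n t j)⟩

/-- Row points lie in the big box. [folklore] -/
theorem row_mem_box {n t j r : ℕ} (ht : t ≤ r) (hj : j ≤ n) :
    (![(n : ℤ) + t, (j : ℤ), 0] : Site 3) ∈ box 3 (n + r) := by
  rw [mem_box]
  intro i
  fin_cases i <;> simp <;> omega

/-- The row endpoint `(n + r, j, 0)` lies on the inner vertex boundary of `B(n + r)`. [folklore] -/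
theorem row_end_mem_innerBoundary {n j r : ℕ} (hj : j ≤ n) :
    (![(n : ℤ) + r, (j : ℤ), 0] : Site 3) ∈ innerBoundary (zdGraph 3) (box 3 (n + r)) := by
  rw [mem_innerBoundary_iff]
  refine ⟨row_mem_box le_rfl hj, ![(n : ℤ) + (r + 1 : ℕ), (j : ℤ), 0], ?_, row_adj n r j⟩
  rw [mem_box]
  intro h
  have := (h 0).2
  simp at this

/-- Row edges in different rows differ (read off the second coordinate). [folklore] -/
theorem row_edge_injective {n t t' j j' : ℕ}
    (h : (s(![(n : ℤ) + t, (j : ℤ), 0], ![(n : ℤ) + (t + 1 : ℕ), (j : ℤ), 0]) : Sym2 (Site 3)) =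
      s(![(n : ℤ) + t', (j' : ℤ), 0], ![(n : ℤ) + (t' + 1 : ℕ), (j' : ℤ), 0])) : j = j' := by
  rw [Sym2.eq_iff] at h
  rcases h with ⟨h1, -⟩ | ⟨h1, -⟩
  · have := congrFun h1 1
    simp at this
    exact_mod_cast this
  · have := congrFun h1 1
    simp at this
    exact_mod_cast this

/-- A row whose edges avoid `S` is an open crossing of `E(ℤ³) \ S` inside `B(n + r)`. [folklore] -/
theorem pathIn_row {n j r : ℕ} (hj : j ≤ n) {S : Set (Sym2 (Site 3))}
    (hS : ∀ t < r, (s(![(n : ℤ) + t, (j : ℤ), 0], ![(n : ℤ) + (t + 1 : ℕ), (j : ℤ), 0]) :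
      Sym2 (Site 3)) ∉ S) :
    ∀ t ≤ r, PathIn (openGraph ((zdGraph 3).edgeSet \ S)) (↑(box 3 (n + r)) : Set (Site 3))
      ![(n : ℤ) + (0 : ℕ), (j : ℤ), 0] ![(n : ℤ) + t, (j : ℤ), 0] := by
  intro t
  induction t with
  | zero => intro _; exact PathIn.refl (Finset.mem_coe.2 (row_mem_box (Nat.zero_le _) hj))
  | succ t ih =>
    intro ht
    refine (ih (by omega)).tail ?_ (Finset.mem_coe.2 (row_mem_box ht hj))
    rw [openGraph_adj]
    exact ⟨⟨(SimpleGraph.mem_edgeSet _).2 (row_adj n t j), hS t (by omega)⟩, (row_adj n t j).ne⟩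

/-- **The full lattice is never budget-`k` blocked once `n ≥ k`**: the rows `j = 0, …, k` are
edge-disjoint crossings and `k` closed edges miss one of them (pigeonhole). [folklore] -/
theorem edgeSet_notMem_blocked {k n : ℕ} (hk : k ≤ n) (r : ℕ) :
    (zdGraph 3).edgeSet ∉ {ω : BondConfig (Site 3) | ∃ S : Finset (Sym2 (Site 3)), S.card ≤ k ∧
      ¬ ∃ x ∈ box 3 n, ∃ y ∈ innerBoundary (zdGraph 3) (box 3 (n + r)),
        (ω \ ↑S) ∈ openConnIn (↑(box 3 (n + r)) : Set (Site 3)) x y} := by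
  rintro ⟨S, hSk, hS⟩
  have hrow : ∃ j ≤ k, ∀ t < r, (s(![(n : ℤ) + t, (j : ℤ), 0], ![(n : ℤ) + (t + 1 : ℕ), (j : ℤ), 0]) :
      Sym2 (Site 3)) ∉ (S : Set (Sym2 (Site 3))) := by
    by_contra hcon
    push Not at hcon
    choose t ht hmem using fun j : Fin (k + 1) => hcon j (Nat.lt_succ_iff.1 j.2)
    let f : Fin (k + 1) → S := fun j =>
      ⟨s(![(n : ℤ) + t j, ((j : ℕ) : ℤ), 0], ![(n : ℤ) + (t j + 1 : ℕ), ((j : ℕ) : ℤ), 0]), hmem j⟩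
    have hf : Function.Injective f := by
      intro j j' hjj'
      exact Fin.ext (row_edge_injective (congrArg Subtype.val hjj'))
    have := Fintype.card_le_of_injective f hf
    simp only [Fintype.card_fin, Fintype.card_coe] at this
    omega
  obtain ⟨j, hj, hjS⟩ := hrow
  have hjn : j ≤ n := hj.trans hk
  refine hS ⟨![(n : ℤ) + (0 : ℕ), (j : ℤ), 0], ?_, ![(n : ℤ) + r, (j : ℤ), 0],
    row_end_mem_innerBoundary hjn, mem_openConnIn_of_pathIn (pathIn_row hjn hjS r le_rfl)⟩
  rw [mem_box]
  intro i
  fin_cases i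
  · simp
  · simp; omega
  · simp

/-- **NEGATIVE LEMMA — the crux at `p = 1` is FALSE**: replacing `p_c(ℤ³)` by `1` in `BudgetTightness`
gives a false statement (`P_1 = δ_{E(ℤ³)}` and `edgeSet_notMem_blocked`). Since the budget events are
decreasing, `{p | tightness at p}` is a down-set of `[0,1]`; this shows it is proper, so any proof of
r2 must use `p_c(ℤ³) < 1`. [folklore] -/
theorem budgetTightness_at_one_false :
    ¬ ∃ (k l : ℕ) (c : ℝ), 2 ≤ l ∧ 0 < c ∧ ∀ N : ℕ, ∃ n : ℕ, N ≤ n ∧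
      c ≤ (bondPercolation (zdGraph 3) 1).real
        {ω : BondConfig (Site 3) | ∃ S : Finset (Sym2 (Site 3)), S.card ≤ k ∧
          ¬ ∃ x ∈ box 3 n, ∃ y ∈ innerBoundary (zdGraph 3) (box 3 (l * n)),
            (ω \ ↑S) ∈ openConnIn (↑(box 3 (l * n)) : Set (Site 3)) x y} := by
  rintro ⟨k, l, c, hl, hc, h⟩
  obtain ⟨n, hn, hcn⟩ := h k
  obtain ⟨l', rfl⟩ : ∃ l', l = l' + 1 := ⟨l - 1, by omega⟩
  have hln : (l' + 1) * n = n + l' * n := by ring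
  rw [hln, bondPercolation_one, measureReal_def, Measure.dirac_apply,
    Set.indicator_of_notMem (edgeSet_notMem_blocked hn (l' * n)), ENNReal.toReal_zero] at hcn
  exact absurd hcn (not_le.2 hc)

/-! ## Kill propagation -/

/-- **X ⇒ r2 (`k = 0`)**, contrapositive: a refutation of the crux refutes the route's target
`CritAnnulusBlockedIO`. [folklore] -/
theorem not_critAnnulusBlockedIO_of_not_budgetTightness
    (h : ¬ Theses.PercBudgetLadder.BudgetTightness) :
    ¬ Theses.PercBudgetLadder.CritAnnulusBlockedIO := by
  rintro ⟨l, c, hl, hc, hX⟩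
  refine h ⟨0, l, c, hl, hc, fun N => ?_⟩
  obtain ⟨n, hn, hcn⟩ := hX N
  refine ⟨n, hn, hcn.trans (measureReal_mono ?_)⟩
  intro ω hω
  exact ⟨∅, le_rfl, by simpa using hω⟩

/-- **X_B ⇒ r2**, contrapositive: a refutation of the crux refutes `CritAnnulusNonCrossing` of route
`PercAnnulusCrossing` (`P_{p_c}(B(n) ↔ ∂B(2n) in B(2n)) ≤ 1 - c` for all `n ≥ 1`; complement, `k = 0`,
`l = 2`). [folklore] -/
theorem not_critAnnulusNonCrossing_of_not_budgetTightness
    (h : ¬ Theses.PercBudgetLadder.BudgetTightness) :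
    ¬ Theses.PercAnnulusCrossing.CritAnnulusNonCrossing := by
  rintro ⟨c, hc, hX⟩
  refine h ⟨0, 2, c, le_rfl, hc, fun N => ⟨N + 1, by omega, ?_⟩⟩
  have hn := hX (N + 1) (by omega)
  set A : Set (BondConfig (Site 3)) := {ω | ∃ x ∈ box 3 (N + 1),
      ∃ y ∈ innerBoundary (zdGraph 3) (box 3 (2 * (N + 1))),
        ω ∈ openConnIn (↑(box 3 (2 * (N + 1))) : Set (Site 3)) x y} with hA
  have hB : {ω : BondConfig (Site 3) | ∃ S : Finset (Sym2 (Site 3)), S.card ≤ 0 ∧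
      ¬ ∃ x ∈ box 3 (N + 1), ∃ y ∈ innerBoundary (zdGraph 3) (box 3 (2 * (N + 1))),
        (ω \ ↑S) ∈ openConnIn (↑(box 3 (2 * (N + 1))) : Set (Site 3)) x y} = Aᶜ := by
    ext ω
    simp only [Set.mem_setOf_eq, Nat.le_zero, Finset.card_eq_zero, Set.mem_compl_iff, hA]
    constructor
    · rintro ⟨S, rfl, h⟩; simpa using h
    · intro h; exact ⟨∅, rfl, by simpa using h⟩
  have hmeasB : MeasurableSet {ω : BondConfig (Site 3) | ∃ S : Finset (Sym2 (Site 3)), S.card ≤ 0 ∧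
      ¬ ∃ x ∈ box 3 (N + 1), ∃ y ∈ innerBoundary (zdGraph 3) (box 3 (2 * (N + 1))),
        (ω \ ↑S) ∈ openConnIn (↑(box 3 (2 * (N + 1))) : Set (Site 3)) x y} := by
    have hset : {ω : BondConfig (Site 3) | ∃ S : Finset (Sym2 (Site 3)), S.card ≤ 0 ∧
        ¬ ∃ x ∈ box 3 (N + 1), ∃ y ∈ innerBoundary (zdGraph 3) (box 3 (2 * (N + 1))),
          (ω \ ↑S) ∈ openConnIn (↑(box 3 (2 * (N + 1))) : Set (Site 3)) x y} =
        {ω | minOpenCutIn (↑(box 3 (2 * (N + 1))) : Set (Site 3)) ↑(box 3 (N + 1))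
          ↑(innerBoundary (zdGraph 3) (box 3 (2 * (N + 1)))) ω ≤ ((0 : ℕ) : ℕ∞)} := by
      ext ω
      rw [Set.mem_setOf_eq, Set.mem_setOf_eq, minOpenCutIn_le_iff]
      simp only [Finset.mem_coe]
    rw [hset]
    exact measurableSet_setOf_minOpenCutIn_le (Finset.finite_toSet _) _ _ 0
  have hmeasA : MeasurableSet A := by
    have := hmeasB.compl
    rwa [hB, compl_compl] at this
  rw [hB, measureReal_compl hmeasA, probReal_univ]
  linarith

end Summit.CriticalPhenomena.PercolationContinuityZ3.Theorems.BudgetTightness.Negative
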